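import Summits.BirchSwinnertonDyer.BirchSwinnertonDyer.Theorems.CongruentShaFreeCutKatoBDPReciprocityUpTo
import Summits.BirchSwinnertonDyer.BirchSwinnertonDyer.Theorems.CongruentShaFreeCutKatoZetaRoadReadings
import Summits.BirchSwinnertonDyer.BirchSwinnertonDyer.Theorems.CongruentShaFreeCutKatoReading31
import Summits.BirchSwinnertonDyer.BirchSwinnertonDyer.Theorems.CongruentShaFreeCutKatoReading31b
import Literature.NumberTheory.EllipticCurves.Kato2004.IwasawaCohomologyExistsProofs
import Literature.NumberTheory.EllipticCurves.Kato2004.LocPKernelRankOneProofs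
import HarnessLib

set_option linter.dupNamespace false -- `Summit.BirchSwinnertonDyer.BirchSwinnertonDyer.Theorems.…` (summit = sub)
set_option autoImplicit false

/-! # Route `CongruentShaFreeCut` (rung S2) — crux B `AnalyticRankOneOfRankOneFiniteShaTwo`
# (stmt-BirchSwinnertonDyer-19080): the END-STATE CENSUS of the Kato–zeta / Perrin-Riou road at the registered
# line `kato-zeta-perrin-riou` **v1e** (plan g16, 2026-08-27T02:09:50Z) — crux B BY NAME from NINE NAMED FACTS
# (+ two tree theorems) and ONE research statement; and the same with the research statement DECOMPOSED as
# EV♯∃ ∧ (ERL♯) (`CongruentShaFreeCutKatoBDPReciprocityUpTo`)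

Cell `bsd-cn100`, prover seat `bsd-cn100-s2-c3` (g9); the S2 twin of s2b-c3 g6's
`MordellShaFreeCutKatoZetaRoadFactsCensus.lean` (p472508), written at v1e: conjuncts 7 and 11 of the v1d
bundle are meanwhile TREE THEOREMS (`Kato2004.nonempty_iwasawaH1Data_holds`, bsd-potss;
`Kato2004.locP_kernel_isTorsion_of_rankOne_holds`, this seat with bsd-cn100-transfer-2, p484260) and are fed
by name. THEOREMS ONLY. Supports, does not close, stmt-BirchSwinnertonDyer-19080.

* `cruxB_of_namedFacts_of_prFormulaH2` — crux B ⟸ six refereed theorems (`2`-parity, modularity,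
  Hoffstein–Luo, Kato finiteness, Heegner points, Gross–Zagier + Kolyvagin) ∧ three READING-grade typed Kato
  facts (`nonempty_iwasawaH2Data`, `thm12_4`, `finite_descentCokernel_of_rankOne`) ∧ `PRFormulaAtTwoH2`;
* `cruxB_of_refereedInputs_of_prFormulaH2` — the same from the registered v1e stub's 9-conjunct bundle TOKEN FOR
  TOKEN (so a proof of `stub_prFormulaAtTwo` closes crux B in one line modulo `stub_refereedInputs`);
* `cruxB_of_refereedInputs_of_bdpExistsValueUpTo_of_reciprocity` — **the two roads MERGED**: crux B ⟸ the
  9-conjunct bundle ∧ EV♯∃ (`TwoAdicBDPElementExistsWithValueUpTo`, the registered ∃∧ stub of crux A's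
  line on stmt-19079) ∧ (ERL♯) (`TwoAdicKatoBDPReciprocityUpTo`, p486660) — via
  `prFormulaAtTwoH2_of_bdpExistsValueUpTo_of_reciprocity`. Compare the BDP road's census
  `cruxB_of_bdpExistsValueUpTo` (p478969): crux B ⟸ EV♯∃ ∧ (LB-wan♯) ∧ six refereed facts. On the
  kato-zeta road (ERL♯) ∧ three Kato facts play the role (LB-wan♯) plays on the BDP road.

HONEST FRAMING: CONDITIONAL reductions; nothing here proves crux B, `PRFormulaAtTwoH2`, EV♯∃, (ERL♯), the leaf
`rankOne_twoConverse_congruentNumber`, the congruent number problem or any case of BSD. PARTITION: none —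
RANK axis.

[cite: AlpogeBhargavaShnidman2022, App. A Thm. 10.1, Thm. 10.6, Thm. 10.8, §10.1.3 (pp. 33–34)]
[cite: Kato2004Asterisque, Thm. 12.4 (p. 221), (14.9.3) (p. 240), §14.14 (p. 243), Cor. 14.3 (p. 235)]
[cite: BertoliniDarmonVenerucci2022, Thm. A (nearest refereed prior art of the formula: semistable odd p)]
-/

noncomputable section

open scoped Classical

open WeierstrassCurve NumberField IsDedekindDomain Field Literature.NumberTheory.EllipticCurves
  Literature.NumberTheory.EllipticCurves.ModularForms
  Literature.NumberTheory.EllipticCurves.Kato2004 Literature.NumberTheory.EllipticCurves.IwasawaAlgebra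
  Literature.NumberTheory.EllipticCurves.Kato2004.EulerSystemValues
  Literature.NumberTheory.GaloisRepresentations
  Summit.BirchSwinnertonDyer.Rank1Residual.Additive
  Summit.BirchSwinnertonDyer.BirchSwinnertonDyer.Theses.CongruentShaFreeCut
  Summit.BirchSwinnertonDyer.BirchSwinnertonDyer.Theorems.CongruentShaFreeCutKatoDescentDatumOfH2
  Summit.BirchSwinnertonDyer.BirchSwinnertonDyer.Theorems.CongruentShaFreeCutKatoZetaRoadPinnedH2
open Summit.BirchSwinnertonDyer.BirchSwinnertonDyer.Theorems.CongruentShaFreeCutTwoAdicBDPExistsValueUpTo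
  (TwoAdicBDPElementExistsWithValueUpTo)
open Summit.BirchSwinnertonDyer.BirchSwinnertonDyer.Theorems.CongruentShaFreeCutKatoBDPReciprocityUpTo
  (TwoAdicKatoBDPReciprocityUpTo prFormulaAtTwoH2_of_bdpExistsValueUpTo_of_reciprocity)

namespace Summit.BirchSwinnertonDyer.BirchSwinnertonDyer.Theorems.CongruentShaFreeCutKatoZetaRoadFactsCensus

/-- **Crux B `AnalyticRankOneOfRankOneFiniteShaTwo` (stmt-BirchSwinnertonDyer-19080) from NINE NAMED FACTS and
Perrin-Riou's formula** — the end-state census of the Kato–zeta road at v1e, every hypothesis a named tree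
`Prop`: six refereed theorems (`2`-parity, modularity, Hoffstein–Luo, Kato finiteness, Heegner points,
Gross–Zagier + Kolyvagin), three reading-grade typed Kato statements (`nonempty_iwasawaH2Data`, `thm12_4`,
`finite_descentCokernel_of_rankOne`), and the ONE research statement `PRFormulaAtTwoH2`; the former conjuncts
`nonempty_iwasawaH1Data` and `locP_kernel_isTorsion_of_rankOne` are the tree theorems `…_holds`. Proof:
`cruxB_of_prFormulaH2_of_readings` (p465073) with (R+K) := `readingRK_congruentNumberCurve_of_facts`, (3.1′) :=
`reading31_of_fact`, (3.1″) := `reading31b_two_of_fact locP_kernel_isTorsion_of_rankOne_holds`. CONDITIONAL on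
the ten displayed hypotheses; closes nothing.
[cite: AlpogeBhargavaShnidman2022, App. A Thm. 10.1, Thm. 10.6, Thm. 10.8, §10.1.3 (pp. 33–34)]
[cite: Kato2004Asterisque, Thm. 12.4 (p. 221), (14.9.3) (p. 240), §14.14 (p. 243), Cor. 14.3 (p. 235)] -/
theorem cruxB_of_namedFacts_of_prFormulaH2
    (hpar : ∀ (W : WeierstrassCurve ℚ) [W.IsElliptic] (p : ℕ) [Fact p.Prime], p_parity W p)
    (hmod : ModularForms.exists_isNewformOf) (hHL : HoffsteinLuo1997_exists_twist_L_one_ne_zero)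
    (hKato : ∀ (W : WeierstrassCurve ℚ) [W.IsElliptic] (p : ℕ) [Fact p.Prime],
      kato_finite_of_L_one_ne_zero W p)
    (hHP : ∀ (W : WeierstrassCurve ℚ) (K : Type) [Field K] [NumberField K],
      exists_isHeegnerPoint W K)
    (hGZ : ∀ (W : WeierstrassCurve ℚ) (N : ℕ) [NeZero N] (K : Type) [Field K] [NumberField K],
      analyticRankEK_eq_one_iff_heegner_nonTorsion W N K)
    (h2 : nonempty_iwasawaH2Data) (h12 : thm12_4) (h31 : finite_descentCokernel_of_rankOne)
    (hPR : PRFormulaAtTwoH2) :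
    AnalyticRankOneOfRankOneFiniteShaTwo :=
  cruxB_of_prFormulaH2_of_readings hpar hmod hHL hKato hHP hGZ
    (CongruentShaFreeCutKatoZetaRoadReadings.readingRK_congruentNumberCurve_of_facts
      nonempty_iwasawaH1Data_holds h2 h12)
    (CongruentShaFreeCutKatoReading31.reading31_of_fact h31)
    (CongruentShaFreeCutKatoReading31b.reading31b_two_of_fact locP_kernel_isTorsion_of_rankOne_holds) hPR

/-- **The registered v1e skeleton's composition as a tree theorem**: crux B from the 9-conjunct bundle of the
registered stub `stub_refereedInputs` of line `kato-zeta-perrin-riou` v1e (the six refereed facts ∧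
`nonempty_iwasawaH2Data ∧ thm12_4 ∧ finite_descentCokernel_of_rankOne`, token for token) and
`PRFormulaAtTwoH2` (= `stub_prFormulaAtTwo`) — so a proof of the research formula closes crux B in one
line modulo the citation-borne bundle. CONDITIONAL; closes nothing.
[cite: AlpogeBhargavaShnidman2022, App. A Thm. 10.1 and §10.1.3 (pp. 33–34)] [cite: Kato2004Asterisque, Thm. 12.4, (14.9.3), §14.14] -/
theorem cruxB_of_refereedInputs_of_prFormulaH2
    (RI : (∀ (W : WeierstrassCurve ℚ) [W.IsElliptic] (p : ℕ) [Fact p.Prime], p_parity W p) ∧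
      ModularForms.exists_isNewformOf ∧
      HoffsteinLuo1997_exists_twist_L_one_ne_zero ∧
      (∀ (W : WeierstrassCurve ℚ) [W.IsElliptic] (p : ℕ) [Fact p.Prime],
        kato_finite_of_L_one_ne_zero W p) ∧
      (∀ (W : WeierstrassCurve ℚ) (K : Type) [Field K] [NumberField K], exists_isHeegnerPoint W K) ∧
      (∀ (W : WeierstrassCurve ℚ) (N : ℕ) [NeZero N] (K : Type) [Field K] [NumberField K],
        analyticRankEK_eq_one_iff_heegner_nonTorsion W N K) ∧
      nonempty_iwasawaH2Data ∧ thm12_4 ∧ finite_descentCokernel_of_rankOne)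
    (hPR : PRFormulaAtTwoH2) :
    AnalyticRankOneOfRankOneFiniteShaTwo :=
  cruxB_of_namedFacts_of_prFormulaH2 RI.1 RI.2.1 RI.2.2.1 RI.2.2.2.1 RI.2.2.2.2.1 RI.2.2.2.2.2.1
    RI.2.2.2.2.2.2.1 RI.2.2.2.2.2.2.2.1 RI.2.2.2.2.2.2.2.2 hPR

/-- **THE TWO ROADS TO CRUX B, MERGED**: crux B ⟸ the registered 9-conjunct citation bundle ∧ EV♯∃
(`TwoAdicBDPElementExistsWithValueUpTo`: ONE `2`-adic ♯-BDP frame with its value at 𝟙 — the registered ∃∧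
stub of crux A's line on stmt-19079) ∧ (ERL♯) (`TwoAdicKatoBDPReciprocityUpTo`: the Kato ↔ BDP reciprocity at
𝟙 up to a non-zero constant) — Perrin-Riou's formula being their consequence
(`prFormulaAtTwoH2_of_bdpExistsValueUpTo_of_reciprocity`). On the kato-zeta road «(ERL♯) ∧ three Kato
readings» plays the part «(LB-wan♯)» plays on the BDP road (`cruxB_of_bdpExistsValueUpTo`, p478969); EV♯∃ is
COMMON to both. CONDITIONAL; closes nothing.
[cite: AlpogeBhargavaShnidman2022, App. A Thm. 10.8 (a) (p. 33) and §2 after Thm. 2.10]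
[cite: BertoliniDarmonPrasanna2013, Thm. 5.13 (shape)] -/
theorem cruxB_of_refereedInputs_of_bdpExistsValueUpTo_of_reciprocity
    (RI : (∀ (W : WeierstrassCurve ℚ) [W.IsElliptic] (p : ℕ) [Fact p.Prime], p_parity W p) ∧
      ModularForms.exists_isNewformOf ∧
      HoffsteinLuo1997_exists_twist_L_one_ne_zero ∧
      (∀ (W : WeierstrassCurve ℚ) [W.IsElliptic] (p : ℕ) [Fact p.Prime],
        kato_finite_of_L_one_ne_zero W p) ∧
      (∀ (W : WeierstrassCurve ℚ) (K : Type) [Field K] [NumberField K], exists_isHeegnerPoint W K) ∧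
      (∀ (W : WeierstrassCurve ℚ) (N : ℕ) [NeZero N] (K : Type) [Field K] [NumberField K],
        analyticRankEK_eq_one_iff_heegner_nonTorsion W N K) ∧
      nonempty_iwasawaH2Data ∧ thm12_4 ∧ finite_descentCokernel_of_rankOne)
    (hEV : TwoAdicBDPElementExistsWithValueUpTo) (hERL : TwoAdicKatoBDPReciprocityUpTo) :
    AnalyticRankOneOfRankOneFiniteShaTwo :=
  cruxB_of_refereedInputs_of_prFormulaH2 RI (prFormulaAtTwoH2_of_bdpExistsValueUpTo_of_reciprocity hEV hERL)

end Summit.BirchSwinnertonDyer.BirchSwinnertonDyer.Theorems.CongruentShaFreeCutKatoZetaRoadFactsCensus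

end
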